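import Mathlib.FieldTheory.Galois.Basic
import Mathlib.FieldTheory.Normal.Closure
import Mathlib.FieldTheory.IsAlgClosed.Basic
import Mathlib.Analysis.Complex.Polynomial.Basic
import HarnessLib

/-!
# The Galois group of `E / ⋂ᵢ Kᵢ` is generated by the Galois groups of the `E / Kᵢ`; Galois hulls inside `ℂ`

Topic `Literature/FieldTheory/Galois`, namespace `Literature.FieldTheory.Galois`.  THEOREMS ONLY, all proved from
Mathlib's fundamental theorem of Galois theory (no definition, no named fact, no instance; net debt 0).
Cell `hodgecm-mathlib` (D-0151), fan A rung A-I (binder `hDel`), row I-6 `descentToIntersection_printed`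
`_holds` programme (lead A-p08), PIECE P2 «Galois bookkeeping»: Deligne's descent of the canonical model from the
reflex fields `Eᵢ` to their intersection `E = ⋂ᵢ Eᵢ` ([Deligne1971] Prop. 5.10 with Lemme 5.10.1) glues the Galois
descent data along the subgroups `Gal(E′/Eᵢ)` of `Gal(E′/E)` for a finite Galois hull `E′ ⊇ Eᵢ`; this needs
(§1) that these subgroups GENERATE `Gal(E′/E)` — the Galois correspondence turns `⋂ᵢ Kᵢ = ⊥` into
`⨆ᵢ Gal(E′/Kᵢ) = ⊤` — in the WORD form «every `σ` is a product of automorphisms each fixing some `Kᵢ`», and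
(§2) the existence of a finite Galois hull `E′ ⊂ ℂ` of finitely many number fields `Eᵢ ⊂ ℂ`.

* §1 `IntermediateField.fixingSubgroup_iInf_eq_iSup` — `Gal(E/⨅ Kᵢ) = ⨆ Gal(E/Kᵢ)` (finite Galois `E/F`);
  `iSup_fixingSubgroup_eq_top_of_iInf_eq_bot`; `closure_iUnion_fixingSubgroup_eq_top_of_iInf_eq_bot`;
  the induction principle `gal_induction_of_iInf_eq_bot` (words in the `Gal(E/Kᵢ)`).
* §2 `Complex.exists_intermediateField_isGalois_forall_le` — finitely many finite `Eᵢ ⊂ ℂ` lie in a finite Galois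
  `E′ ⊂ ℂ` (normal closure of their compositum inside `ℂ`); `Complex.exists_intermediateField_isGalois_iInf_le_forall_le`
  (the same, recording `⨅ Eᵢ ≤ E′`).

## References
* [Deligne1971] P. Deligne, *Travaux de Shimura*, Sém. Bourbaki 389 (1971), Prop. 5.10, Lemme 5.10.1 (p. 157).
* [Lang2002] S. Lang, *Algebra*, GTM 211, Ch. VI §1, Thm. 1.2 and Cor. 1.6 (Galois correspondence is an
  inclusion-reversing lattice isomorphism; `K₁ ∩ K₂ ↔ ⟨H₁, H₂⟩`), Ch. V §3 (normal closure).
-/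

set_option autoImplicit false

namespace Literature.FieldTheory.Galois

/-! ## §1 `Gal(E/⨅ Kᵢ)` is generated by the `Gal(E/Kᵢ)` -/

section GaloisCorrespondence

variable {F E : Type*} [Field F] [Field E] [Algebra F E] [FiniteDimensional F E] [IsGalois F E]

/-- **The Galois correspondence exchanges intersections of fields with joins of groups**: for a finite Galois
extension `E/F` and any family of intermediate fields `Kᵢ`, `Gal(E/⋂ᵢ Kᵢ) = ⨆ᵢ Gal(E/Kᵢ)` as subgroups of
`Gal(E/F)` (the correspondence `K ↦ Gal(E/K)` is an order ANTI-isomorphism, Mathlib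
`IsGalois.intermediateFieldEquivSubgroup`, hence maps infima to suprema). [cite: Lang2002, Ch. VI §1 Cor. 1.6] -/
theorem _root_.IntermediateField.fixingSubgroup_iInf_eq_iSup {ι : Sort*} (K : ι → IntermediateField F E) :
    (⨅ i, K i).fixingSubgroup = ⨆ i, (K i).fixingSubgroup := by
  -- `e (⨅ i, K i) = ⨅ i, e (K i)` in the order dual `(Subgroup Gal(E/F))ᵒᵈ`, where `e K = toDual (Gal(E/K))`;
  -- an infimum in the order dual IS the supremum (definitionally), so this is the claim
  exact map_iInf (IsGalois.intermediateFieldEquivSubgroup (F := F) (E := E)) K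

/-- **If `⋂ᵢ Kᵢ = F` then the `Gal(E/Kᵢ)` generate `Gal(E/F)`**: `⨆ᵢ Gal(E/Kᵢ) = ⊤` (finite Galois `E/F`;
`Gal(E/F) = Gal(E/⊥)`, Mathlib `IntermediateField.fixingSubgroup_bot`). [cite: Lang2002, Ch. VI §1 Cor. 1.6] -/
theorem _root_.IntermediateField.iSup_fixingSubgroup_eq_top_of_iInf_eq_bot {ι : Sort*}
    (K : ι → IntermediateField F E) (h : ⨅ i, K i = ⊥) : ⨆ i, (K i).fixingSubgroup = ⊤ := by
  rw [← IntermediateField.fixingSubgroup_iInf_eq_iSup, h, IntermediateField.fixingSubgroup_bot]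

/-- **Closure form**: if `⋂ᵢ Kᵢ = F`, the subgroup of `Gal(E/F)` generated by the automorphisms fixing SOME `Kᵢ`
pointwise is everything (`Subgroup.closure (⋃ᵢ Gal(E/Kᵢ)) = ⊤`, Mathlib `Subgroup.closure_iUnion`).
[cite: Lang2002, Ch. VI §1 Cor. 1.6] -/
theorem _root_.IntermediateField.closure_iUnion_fixingSubgroup_eq_top_of_iInf_eq_bot {ι : Sort*}
    (K : ι → IntermediateField F E) (h : ⨅ i, K i = ⊥) :
    Subgroup.closure (⋃ i, ((K i).fixingSubgroup : Set Gal(E/F))) = ⊤ := by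
  rw [Subgroup.closure_iUnion]
  simpa only [Subgroup.closure_eq] using IntermediateField.iSup_fixingSubgroup_eq_top_of_iInf_eq_bot K h

/-- **Word form (the induction principle used to glue descent data, [Deligne1971] Lemme 5.10.1)**: if `⋂ᵢ Kᵢ = F`,
a predicate on `Gal(E/F)` that holds at `1`, is stable under products, and holds for every automorphism fixing
some `Kᵢ` pointwise, holds everywhere — every `σ ∈ Gal(E/F)` is a finite product `σ₁ ⋯ σₘ` with each `σⱼ`
fixing some `K_{i(j)}` (no inverses needed: the `Gal(E/Kᵢ)` are subgroups; Mathlib `Subgroup.iSup_induction`).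
[cite: Deligne1971, Lemme 5.10.1 (p. 157)] [cite: Lang2002, Ch. VI §1 Cor. 1.6] -/
theorem _root_.IntermediateField.gal_induction_of_iInf_eq_bot {ι : Sort*} (K : ι → IntermediateField F E)
    (h : ⨅ i, K i = ⊥) {P : Gal(E/F) → Prop} (one : P 1) (mul : ∀ σ τ : Gal(E/F), P σ → P τ → P (σ * τ))
    (base : ∀ (i : ι) (σ : Gal(E/F)), (∀ x ∈ K i, σ x = x) → P σ) (σ : Gal(E/F)) : P σ := by
  have hσ : σ ∈ ⨆ i, (K i).fixingSubgroup := by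
    rw [IntermediateField.iSup_fixingSubgroup_eq_top_of_iInf_eq_bot K h]
    exact Subgroup.mem_top σ
  exact Subgroup.iSup_induction (fun i => (K i).fixingSubgroup) (C := P) hσ
    (fun i τ hτ => base i τ ((IntermediateField.mem_fixingSubgroup_iff (K i) τ).1 hτ)) one mul

/-- **Two-field case**: `Gal(E/(K₁ ∩ K₂)) = Gal(E/K₁) ⊔ Gal(E/K₂)`. [cite: Lang2002, Ch. VI §1 Cor. 1.6] -/
theorem _root_.IntermediateField.fixingSubgroup_inf_eq_sup (K₁ K₂ : IntermediateField F E) :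
    (K₁ ⊓ K₂).fixingSubgroup = K₁.fixingSubgroup ⊔ K₂.fixingSubgroup := by
  rw [inf_eq_iInf, sup_eq_iSup, IntermediateField.fixingSubgroup_iInf_eq_iSup]
  congr 1
  funext b
  cases b <;> rfl

end GaloisCorrespondence

/-! ## §2 Finite Galois hulls inside `ℂ` -/

section Hull

/-- **Finitely many number fields inside `ℂ` lie in a common finite Galois extension of `ℚ` inside `ℂ`**: the normal
closure over `ℚ` of their compositum `⨆ᵢ Eᵢ` inside `ℂ` (all generators algebraic and `ℂ` algebraically closed, so
the normal closure inside `ℂ` is normal; separability is automatic in characteristic `0`).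
[cite: Lang2002, Ch. V §3 (normal closure) and Ch. VI §1 Thm. 1.2] -/
theorem Complex.exists_intermediateField_isGalois_forall_le {ι : Type*} [Finite ι]
    (E : ι → IntermediateField ℚ ℂ) [∀ i, FiniteDimensional ℚ (E i)] :
    ∃ E' : IntermediateField ℚ ℂ, FiniteDimensional ℚ E' ∧ IsGalois ℚ E' ∧ ∀ i, E i ≤ E' := by
  classical
  let M : IntermediateField ℚ ℂ := ⨆ i, E i
  haveI : FiniteDimensional ℚ M := IntermediateField.finiteDimensional_iSup_of_finite
  let N : IntermediateField ℚ ℂ := IntermediateField.normalClosure ℚ ↥M ℂ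
  haveI : FiniteDimensional ℚ N := normalClosure.is_finiteDimensional ℚ ↥M ℂ
  have hnc : IsNormalClosure ℚ ↥M ↥N :=
    Algebra.IsAlgebraic.isNormalClosure_normalClosure (fun x => IsAlgClosed.splits _)
  haveI : Normal ℚ N := hnc.normal
  haveI : IsGalois ℚ N := IsGalois.mk
  exact ⟨N, inferInstance, inferInstance, fun i => (le_iSup E i).trans (IntermediateField.le_normalClosure M)⟩

/-- **The same hull, recording that it contains the intersection**: for finitely many number fields `Eᵢ ⊂ ℂ` there is
a finite Galois `E′/ℚ` inside `ℂ` with `⋂ᵢ Eᵢ ≤ Eᵢ ≤ E′` for all `i` (the case `ι` empty included: `E′ = ℚ` works for the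
vacuous inclusions, and `⨅` over the empty family is `⊤`, so the first clause is only claimed for NONEMPTY `ι`).
[cite: Lang2002, Ch. V §3 and Ch. VI §1 Thm. 1.2] -/
theorem Complex.exists_intermediateField_isGalois_iInf_le_forall_le {ι : Type*} [Finite ι] [Nonempty ι]
    (E : ι → IntermediateField ℚ ℂ) [∀ i, FiniteDimensional ℚ (E i)] :
    ∃ E' : IntermediateField ℚ ℂ, FiniteDimensional ℚ E' ∧ IsGalois ℚ E' ∧ (⨅ i, E i) ≤ E' ∧ ∀ i, E i ≤ E' := by
  obtain ⟨E', h₁, h₂, h₃⟩ := Complex.exists_intermediateField_isGalois_forall_le E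
  obtain ⟨i⟩ := ‹Nonempty ι›
  exact ⟨E', h₁, h₂, (iInf_le E i).trans (h₃ i), h₃⟩

end Hull

end Literature.FieldTheory.Galois
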